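import Literature.Computability.Complexity.PCPSubsetNP
import Literature.Computability.Complexity.IndexAllBricks
import Literature.Computability.Complexity.FoldCatBricks
import Literature.Computability.Complexity.CyclicListBricks
import Literature.Computability.Complexity.ProbabilisticClassesProofs
import Mathlib.Analysis.SpecialFunctions.Exponential
import HarnessLib

/-!
# Soundness amplification of nonadaptive PCP verifiers: `k`-fold repetition on fresh coin blocks

Literature / complexity toolkit, companion of `PCP.lean` (the model `PCPVerifier` of nonadaptive
probabilistically checkable proofs: `coins`, `queries`, `decide`, `acceptProb`, `IsPolyTime`) and of
`PCPSubsetNP.lean` (the verifier's maps as total `FP` string functions `PCPExact.QF`, `PCPExact.DF`).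
The textbook remark that the constant `1/2` in the definition of `PCP(r, q)` is immaterial
(Arora–Barak 2009, Remark 11.6 (2): "running the verifier `k` times with independent coins and
accepting iff all runs accept leaves completeness `1` and brings the soundness error from `1 - δ` down
to `(1 - δ)ᵏ`, at the price of `k` times more coins and queries") is made into a construction on
`PCPVerifier`, with its three properties PROVED:

* `PCPVerifier.block r j ρ = (ρ ↓ j r) ↾ r` — the `j`-th block of `r` coins of a coin string;
  `PCPVerifier.repDecide` — the sequential decision on a list of coin blocks, peeling off the answer
  segment of each block (`repDecide_flatMap`: on the concatenated answer lists it is the conjunction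
  of the runs);
* **`PCPVerifier.andRep V p q`** — the verifier that on inputs of length `n` uses `q(n) · p(n)` coins,
  queries the concatenation of the query lists of `V` on the `q(n)` blocks of `p(n)` coins, and accepts
  iff every run accepts (`accepts_andRep_iff`);
* **`PCPVerifier.acceptProb_andRep`** — for a verifier run with exactly `p(n)` coins,
  `Pr[andRep accepts] = Pr[V accepts]^{q(n)}` (product rule on disjoint coin blocks, `cnt_take_drop`),
  whence completeness is kept (`acceptProb_andRep_eq_one`) and a soundness error `≤ s` becomes
  `≤ s^{q(n)}` (`acceptProb_andRep_le_pow`); the numerical fact `(1 - 1/(m+1))^{m+1} ≤ 1/2`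
  (`one_sub_inv_pow_le_half`) turns an error `1 - 1/(m+1)` into `1/2` with `m + 1` repetitions;
* **`PCPVerifier.isPolyTime_andRep`** — `andRep V p q` is polynomial time when `V` is: the query map
  is two concatenation folds (`Brick.foldCat`) of the unary lengths and of the list codes of the
  per-block query lists, the decision map a counted fold (`Brick.foldLoop`) whose accumulator carries
  the not-yet-consumed answers and the conjunction bit (`PCPAmp.QF'`, `PCPAmp.DF'` with their value
  lemmas).

Used to normalise probabilistically checkable proofs for `E` with soundness error `1 - 1/poly` to the
error `1/2` asked by Buhrman–Fortnow–Pavan's Lemma 3.4 (`MetaComplexity/AvgCaseDerandomizationPCP.lean`).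
Everything here is definitions with value lemmas and theorems; no named fact is introduced.

## References

* S. Arora, B. Barak, *Computational Complexity: A Modern Approach*, CUP 2009, Remark 11.6 (2)
  (the constant `1/2` is arbitrary: repetition), Def. 11.4, §1.3 (closure of polynomial time under
  composition and bounded loops) [AroraBarakCC2009].
* S. Arora, S. Safra, *Probabilistic checking of proofs: a new characterization of NP*, J. ACM 45
  (1998), §2.1 (remark after Def. 2.2: error reduction by `O(1)` repetitions) [AroraSafra1998].
-/

noncomputable section

namespace Literature.Computability.Complexity

open _root_.Computability Polynomial Brick

namespace PCPVerifier

variable (V : PCPVerifier)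

/-! ### Coin blocks and the sequential decision -/

/-- The `j`-th block of `r` coins of a coin string: `(ρ ↓ j·r) ↾ r`. [cite: AroraBarakCC2009, Remark 11.6 (2)] -/
def block (r j : ℕ) (ρ : List Bool) : List Bool := (ρ.drop (j * r)).take r

/-- The list of the first `k` blocks of `r` coins. [folklore] -/
def blocks (r k : ℕ) (ρ : List Bool) : List (List Bool) := (List.range k).map fun j => block r j ρ

/-- Block `0` is the prefix of length `r`. [folklore] -/
@[simp] theorem block_zero (r : ℕ) (ρ : List Bool) : block r 0 ρ = ρ.take r := by simp [block]

/-- Block `j + 1` of `ρ` is block `j` of `ρ ↓ r`. [folklore] -/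
theorem block_succ (r j : ℕ) (ρ : List Bool) : block r (j + 1) ρ = block r j (ρ.drop r) := by
  simp only [block, List.drop_drop, Nat.succ_mul, Nat.add_comm]

/-- A block has length `r` once the coin string is long enough. [folklore] -/
theorem length_block {r j : ℕ} {ρ : List Bool} (h : (j + 1) * r ≤ ρ.length) : (block r j ρ).length = r := by
  simp only [block, List.length_take, List.length_drop]
  rw [Nat.succ_mul] at h
  omega

/-- A block is never longer than `r`. [folklore] -/
theorem length_block_le (r j : ℕ) (ρ : List Bool) : (block r j ρ).length ≤ r := by
  simp [block, List.length_take]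

/-- The number of blocks. [folklore] -/
@[simp] theorem length_blocks (r k : ℕ) (ρ : List Bool) : (blocks r k ρ).length = k := by simp [blocks]

/-- The blocks of `ρ` from `k + 1` on: the prefix, then the blocks of `ρ ↓ r`. [folklore] -/
theorem blocks_succ (r k : ℕ) (ρ : List Bool) : blocks r (k + 1) ρ = ρ.take r :: blocks r k (ρ.drop r) := by
  simp only [blocks, List.range_succ_eq_map, List.map_cons, block_zero, List.map_map]
  congr 1
  exact List.map_congr_left fun j _ => by simp [Function.comp, block_succ]

/-- **The sequential decision on a list of coin blocks**: run `V.decide` on the first block with the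
first `|V.queries x ρ₀|` answers, drop them, and continue; accept iff every run accepts.
[cite: AroraBarakCC2009, Remark 11.6 (2)] -/
def repDecide (x : List Bool) : List (List Bool) → List Bool → Bool
  | [], _ => true
  | ρ :: l, a => V.decide x ρ (a.take (V.queries x ρ).length) && repDecide x l (a.drop (V.queries x ρ).length)

/-- On the concatenation of the answer lists of the blocks, the sequential decision is the conjunction
of the runs. [folklore] -/
theorem repDecide_flatMap (x : List Bool) (π : ℕ → Bool) :
    ∀ l : List (List Bool), V.repDecide x l ((l.flatMap fun ρ => V.queries x ρ).map π) =
      l.all fun ρ => V.accepts x π ρ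
  | [] => rfl
  | ρ :: l => by
    rw [repDecide, List.flatMap_cons, List.map_append, List.take_append_of_le_length (by simp),
      List.drop_append_of_le_length (by simp), List.take_of_length_le (by simp),
      List.drop_eq_nil_of_le (by simp), List.nil_append, repDecide_flatMap x π l, List.all_cons]
    rfl

/-! ### The repeated verifier -/

/-- **The `q(n)`-fold repetition of `V` on fresh blocks of `p(n)` coins, accepting iff all runs accept.**
[cite: AroraBarakCC2009, Remark 11.6 (2)] -/
def andRep (p q : Polynomial ℕ) : PCPVerifier where
  coins n := q.eval n * p.eval n
  queries x ρ := (blocks (p.eval x.length) (q.eval x.length) ρ).flatMap fun ρ' => V.queries x ρ'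
  decide x ρ a := V.repDecide x (blocks (p.eval x.length) (q.eval x.length) ρ) a

variable {V}

/-- **The repeated verifier accepts iff every run accepts.** [cite: AroraBarakCC2009, Remark 11.6 (2)] -/
theorem accepts_andRep (p q : Polynomial ℕ) (x : List Bool) (π : ℕ → Bool) (ρ : List Bool) :
    (V.andRep p q).accepts x π ρ =
      (blocks (p.eval x.length) (q.eval x.length) ρ).all fun ρ' => V.accepts x π ρ' := by
  rw [accepts]
  exact V.repDecide_flatMap x π _

/-- The repeated verifier accepts iff every one of the `q(n)` block runs accepts. [folklore] -/
theorem accepts_andRep_iff (p q : Polynomial ℕ) (x : List Bool) (π : ℕ → Bool) (ρ : List Bool) :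
    (V.andRep p q).accepts x π ρ = true ↔
      ∀ j < q.eval x.length, V.accepts x π (block (p.eval x.length) j ρ) = true := by
  rw [accepts_andRep, List.all_eq_true]
  simp only [blocks, List.mem_map, List.mem_range, forall_exists_index, and_imp]
  exact ⟨fun h j hj => h _ j hj rfl, fun h ρ' j hj hρ' => hρ' ▸ h j hj⟩

/-- The query lists of the repeated verifier are at most `q(n)` times longer. [folklore] -/
theorem length_queries_andRep_le {Q : ℕ} (hQ : ∀ x ρ, (V.queries x ρ).length ≤ Q) (p q : Polynomial ℕ)
    (x ρ : List Bool) : ((V.andRep p q).queries x ρ).length ≤ q.eval x.length * Q := by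
  change ((blocks _ _ ρ).flatMap _).length ≤ _
  rw [List.length_flatMap]
  refine (List.sum_le_card_nsmul _ Q ?_).trans ?_
  · intro n hn
    obtain ⟨ρ', -, rfl⟩ := List.mem_map.1 hn
    exact hQ x ρ'
  · simp

/-! ### The product rule: acceptance probability of the repetition -/

/-- **`k` runs on disjoint coin blocks multiply**: `Pr_{ρ ∈ {0,1}^{k r}}[∀ j < k, Q (block r j ρ)] = Pr_ρ[Q ρ]ᵏ`.
[cite: AroraBarakCC2009, §7.4.1 (independent repetitions)] -/
theorem uniformProb_blocks (r : ℕ) (Q : List Bool → Prop) : ∀ k : ℕ,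
    uniformProb (k * r) {ρ | ∀ j < k, Q (block r j ρ)} = uniformProb r {ρ | Q ρ} ^ k
  | 0 => by
    rw [pow_zero, Nat.zero_mul]
    exact uniformProb_eq_one_of_forall fun ρ _ => by simp
  | k + 1 => by
    have hE : {ρ : List Bool | ∀ j < k + 1, Q (block r j ρ)} =
        {ρ | ρ.take r ∈ {ρ' | Q ρ'} ∧ ρ.drop r ∈ {ρ' | ∀ j < k, Q (block r j ρ')}} := by
      ext ρ
      simp only [Set.mem_setOf_eq]
      constructor
      · intro h
        exact ⟨by simpa using h 0 (Nat.succ_pos k), fun j hj => by rw [← block_succ]; exact h (j + 1) (by omega)⟩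
      · rintro ⟨h0, h⟩ j hj
        rcases j with _ | j
        · simpa using h0
        · rw [block_succ]; exact h j (by omega)
    rw [Nat.succ_mul, add_comm, hE, uniformProb_eq_cnt_div, cnt_take_drop, Nat.cast_mul, pow_add,
      ← div_mul_div_comm, ← uniformProb_eq_cnt_div, ← uniformProb_eq_cnt_div, uniformProb_blocks r Q k,
      pow_succ, mul_comm]

/-- **Acceptance probability of the repetition**: for a verifier run with exactly `p(n)` coins,
`Pr[(andRep V p q)^π(x) accepts] = Pr[V^π(x) accepts]^{q(|x|)}`. [cite: AroraBarakCC2009, Remark 11.6 (2)] -/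
theorem acceptProb_andRep {p : Polynomial ℕ} (hc : ∀ n, V.coins n = p.eval n) (q : Polynomial ℕ)
    (x : List Bool) (π : ℕ → Bool) :
    (V.andRep p q).acceptProb x π = V.acceptProb x π ^ q.eval x.length := by
  rw [acceptProb, acceptProb, hc]
  change uniformProb (q.eval x.length * p.eval x.length) _ = _
  rw [← uniformProb_blocks]
  refine congr_arg _ (Set.ext fun ρ => ?_)
  simp only [Set.mem_setOf_eq]
  exact accepts_andRep_iff p q x π ρ

/-- **Completeness is kept.** [cite: AroraBarakCC2009, Remark 11.6 (2)] -/
theorem acceptProb_andRep_eq_one {p : Polynomial ℕ} (hc : ∀ n, V.coins n = p.eval n) (q : Polynomial ℕ)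
    {x : List Bool} {π : ℕ → Bool} (h : V.acceptProb x π = 1) : (V.andRep p q).acceptProb x π = 1 := by
  rw [acceptProb_andRep hc, h, one_pow]

/-- **Soundness is amplified**: an error `≤ s` becomes `≤ s^{q(|x|)}`. [cite: AroraBarakCC2009, Remark 11.6 (2)] -/
theorem acceptProb_andRep_le_pow {p : Polynomial ℕ} (hc : ∀ n, V.coins n = p.eval n) (q : Polynomial ℕ)
    {x : List Bool} {π : ℕ → Bool} {s : ℝ} (h : V.acceptProb x π ≤ s) :
    (V.andRep p q).acceptProb x π ≤ s ^ q.eval x.length := by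
  rw [acceptProb_andRep hc]
  exact pow_le_pow_left₀ (V.acceptProb_nonneg x π) h _

/-- The coin count of the repetition. [folklore] -/
@[simp] theorem coins_andRep (p q : Polynomial ℕ) (n : ℕ) : (V.andRep p q).coins n = q.eval n * p.eval n := rfl

/-- The coin count of the repetition is the polynomial `q · p`. [folklore] -/
theorem coins_andRep_eq (p q : Polynomial ℕ) (n : ℕ) : (V.andRep p q).coins n = (q * p).eval n := by
  rw [coins_andRep, eval_mul]

/-- **The numerical fact**: `(1 - 1/(m+1))^{m+1} ≤ 1/2` (indeed `≤ e⁻¹`). [folklore] -/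
theorem one_sub_inv_pow_le_half (m : ℕ) : (1 - 1 / ((m : ℝ) + 1)) ^ (m + 1) ≤ 1 / 2 := by
  have h1 : (1 - 1 / ((m : ℝ) + 1)) ^ (m + 1) ≤ Real.exp (-1) := by
    have := Real.one_sub_div_pow_le_exp_neg (n := m + 1) (t := 1) (by push_cast; linarith)
    push_cast at this
    exact this
  have h2 : Real.exp (-1) ≤ 1 / 2 := by
    rw [Real.exp_neg, one_div]
    have he : (2 : ℝ) ≤ Real.exp 1 := by
      have := Real.add_one_le_exp (1 : ℝ)
      linarith
    exact inv_anti₀ (by norm_num) he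
  exact h1.trans h2

/-- **Error `1 - 1/(m+1)` becomes `1/2` after `m + 1` repetitions.** [cite: AroraBarakCC2009, Remark 11.6 (2)] -/
theorem acceptProb_andRep_le_half {p : Polynomial ℕ} (hc : ∀ n, V.coins n = p.eval n) {m : Polynomial ℕ}
    {x : List Bool} {π : ℕ → Bool} (h : V.acceptProb x π ≤ 1 - 1 / (((m.eval x.length : ℕ) : ℝ) + 1)) :
    (V.andRep p (m + 1)).acceptProb x π ≤ 1 / 2 := by
  refine (acceptProb_andRep_le_pow hc (m + 1) h).trans ?_
  rw [eval_add, eval_one]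
  exact one_sub_inv_pow_le_half _

end PCPVerifier

/-! ### The maps of the repeated verifier as `FP` string functions -/

namespace PCPAmp

open PCPVerifier PCPExact HashBricks Plumb OracleCompose

variable (V : PCPVerifier) (p q : Polynomial ℕ)

/-- The list code of `BoolEncodings.lean` split into its two fields: the unary length and the framed
items (twin of `ShorFP.listNat_encode_eq`, `Cryptography/ShorStepFP.lean`, which sits above this
toolkit and is not imported here). [folklore] -/
theorem encode_listNat_eq (ks : List ℕ) :
    encodingListNatBool.encode ks = boolPair (ones ks.length) (encList (ks.map encodeNat)) := by
  change boolPair (unaryEncodeNat ks.length)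
    (ks.foldr (fun a acc => boolPair (encodingNatBool.encode a) acc) []) = _
  rw [unaryEncodeNat_eq_replicate]
  congr 1
  induction ks with
  | nil => rfl
  | cons k ks ih =>
    simp only [List.foldr_cons, List.map_cons, encList_cons]
    rw [← ih]
    rfl

/-- **The list code of a concatenation** is the pair of the two concatenation folds (unary lengths,
framed items). [folklore] -/
theorem encode_flatMap (g : ℕ → List ℕ) : ∀ k : ℕ,
    encodingListNatBool.encode ((List.range k).flatMap g) =
      boolPair (ccat (fun t => ones (g t).length) k) (ccat (fun t => encList ((g t).map encodeNat)) k)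
  | 0 => by rw [encode_listNat_eq]; rfl
  | k + 1 => by
    have ih := encode_flatMap g k
    rw [encode_listNat_eq] at ih ⊢
    obtain ⟨h1, h2⟩ := (boolPair_injective' ih)
    rw [List.range_succ, List.flatMap_append, List.flatMap_cons, List.flatMap_nil, List.append_nil,
      List.length_append, List.map_append, encList_append, ccat_succ, ccat_succ, ← h1, ← h2,
      show ∀ a b : ℕ, ones (a + b) = ones a ++ ones b from fun a b => List.replicate_add ..]
where
  /-- `boolPair` is injective in both fields. [folklore] -/
  boolPair_injective' {a b a' b' : List Bool} (h : boolPair a b = boolPair a' b') : a = a' ∧ b = b' := by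
    have := congr_arg boolUnpair h
    rwa [boolUnpair_boolPair, boolUnpair_boolPair, Prod.mk.injEq] at this

/-! #### The blocks -/

/-- On `⟨⟨x, ρ⟩, 1ʲ⟩`: the ruler `1^{p(|x|)}`. [folklore] -/
def rulerF : List Bool → List Bool := polyFn p ∘ fstF ∘ fstF

/-- **The block brick**: on `⟨⟨x, ρ⟩, 1ʲ⟩`, `block (p |x|) j ρ`. [cite: AroraBarakCC2009, Remark 11.6 (2)] -/
def blockF : List Bool → List Bool :=
  takeFn ∘ fanoutFn (rulerF p) (dropFn ∘ fanoutFn (umulFn ∘ fanoutFn sndF (rulerF p)) (sndF ∘ fstF))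

/-- **The piece brick**: on `⟨⟨x, ρ⟩, 1ʲ⟩`, the pair `⟨x, block (p |x|) j ρ⟩` fed to `V`. [folklore] -/
def pieceF : List Bool → List Bool := fanoutFn (fstF ∘ fstF) (blockF p)

variable {p}

/-- Value of the ruler. [folklore] -/
theorem rulerF_apply (x ρ u : List Bool) : rulerF p (boolPair (boolPair x ρ) u) = ones (p.eval x.length) := by
  simp [rulerF]

/-- **Value of the block brick.** [folklore] -/
theorem blockF_apply (x ρ : List Bool) (j : ℕ) :
    blockF p (boolPair (boolPair x ρ) (ones j)) = block (p.eval x.length) j ρ := by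
  simp [blockF, rulerF, block, ones, umulFn_apply]

/-- **Value of the piece brick.** [folklore] -/
theorem pieceF_apply (x ρ : List Bool) (j : ℕ) :
    pieceF p (boolPair (boolPair x ρ) (ones j)) = boolPair x (block (p.eval x.length) j ρ) := by
  rw [pieceF, fanoutFn_apply, blockF_apply]
  simp

/-- The block brick never returns more than the coin field of its context. [folklore] -/
theorem length_blockF_le (w : List Bool) : (blockF p w).length ≤ (sndF (fstF w)).length := by
  simp only [blockF, Function.comp_apply, fanoutFn_apply, takeFn_boolPair, dropFn_boolPair]
  exact (List.length_take_le' _ _).trans (by simp)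

/-- **Linear growth of the piece brick** (on every input): `|pieceF p w| ≤ 2 (|fstF w| + 1)`. [folklore] -/
theorem length_pieceF_le (w : List Bool) : (pieceF p w).length ≤ 2 * ((fstF w).length + 1) := by
  rw [pieceF, length_fanoutFn]
  have h1 := length_blockF_le (p := p) w
  have h2 := length_fstF_sndF_le (fstF w)
  simp only [Function.comp_apply] at h1 ⊢
  omega

/-- On a well-formed context the piece is no longer than the context. [folklore] -/
theorem length_pieceF_apply_le (x ρ : List Bool) (j : ℕ) :
    (pieceF p (boolPair (boolPair x ρ) (ones j))).length ≤ (boolPair x ρ).length := by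
  rw [pieceF_apply, length_boolPair, length_boolPair]
  have := length_block_le (p.eval x.length) j ρ
  have : (block (p.eval x.length) j ρ).length ≤ ρ.length := by
    simp only [block]; exact (List.length_take_le' _ _).trans (by simp)
  omega

/-- `rulerF p ∈ FP`. [folklore] -/
theorem rulerF_mem_FP : rulerF p ∈ FP := comp_mem_FP (polyFn_mem_FP p) (comp_mem_FP fstF_mem_FP fstF_mem_FP)

/-- `blockF p ∈ FP`. [folklore] -/
theorem blockF_mem_FP : blockF p ∈ FP :=
  comp_mem_FP takeFn_mem_FP (fanoutFn_mem_FP rulerF_mem_FP (comp_mem_FP dropFn_mem_FP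
    (fanoutFn_mem_FP (comp_mem_FP umulFn_mem_FP (fanoutFn_mem_FP sndF_mem_FP rulerF_mem_FP))
      (comp_mem_FP sndF_mem_FP fstF_mem_FP))))

/-- `pieceF p ∈ FP`. [folklore] -/
theorem pieceF_mem_FP : pieceF p ∈ FP := fanoutFn_mem_FP (comp_mem_FP fstF_mem_FP fstF_mem_FP) blockF_mem_FP

/-! #### The query map -/

variable (p)

/-- On `z = ⟨x, ρ⟩`: the fold argument `⟨z, 1^{q(|x|)}⟩`. [folklore] -/
def initF : List Bool → List Bool := fanoutFn _root_.id (polyFn q ∘ fstF)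

/-- The unary length `1^{ℓⱼ}` of the query list of block `j`. [folklore] -/
def lenPieceF : List Bool → List Bool := fstF ∘ QF V ∘ pieceF p

/-- The framed items of the query list of block `j`. [folklore] -/
def codePieceF : List Bool → List Bool := sndF ∘ QF V ∘ pieceF p

/-- **The query map of `andRep V p q` as a total string function**: the pair of the two concatenation
folds over the `q(|x|)` blocks (pieces clipped to `Q (|z|)`, `Q` a length bound of `QF V`).
[cite: AroraBarakCC2009, Remark 11.6 (2) with §1.3] -/
def QF' (Q : Polynomial ℕ) : List Bool → List Bool :=
  fanoutFn (foldCat Q q (lenPieceF V p) ∘ initF q) (foldCat Q q (codePieceF V p) ∘ initF q)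

variable {V p q}

/-- `initF q` on a pair. [folklore] -/
theorem initF_boolPair (x ρ : List Bool) : initF q (boolPair x ρ) = boolPair (boolPair x ρ) (ones (q.eval x.length)) := by
  simp [initF]

/-- Value of the length piece. [folklore] -/
theorem lenPieceF_apply (x ρ : List Bool) (j : ℕ) :
    lenPieceF V p (boolPair (boolPair x ρ) (ones j)) = ones (V.queries x (block (p.eval x.length) j ρ)).length := by
  rw [lenPieceF, Function.comp_apply, Function.comp_apply, pieceF_apply, QF_boolPair, encode_listNat_eq, fstF_boolPair]

/-- Value of the code piece. [folklore] -/
theorem codePieceF_apply (x ρ : List Bool) (j : ℕ) :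
    codePieceF V p (boolPair (boolPair x ρ) (ones j)) =
      encList ((V.queries x (block (p.eval x.length) j ρ)).map encodeNat) := by
  rw [codePieceF, Function.comp_apply, Function.comp_apply, pieceF_apply, QF_boolPair, encode_listNat_eq, sndF_boolPair]

/-- **Value of the query map** on a pair, for a clip `Q` bounding `|QF V w| ≤ Q (|w|)`:
`QF' ⟨x, ρ⟩ = encode ((andRep V p q).queries x ρ)`. [cite: AroraBarakCC2009, Remark 11.6 (2)] -/
theorem QF'_boolPair {Q : Polynomial ℕ} (hQ : ∀ w, (QF V w).length ≤ Q.eval w.length) (x ρ : List Bool) :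
    QF' V p q Q (boolPair x ρ) = encodingListNatBool.encode ((V.andRep p q).queries x ρ) := by
  have hk : (ones (q.eval x.length)).length ≤ q.eval (boolPair x ρ).length := by
    rw [List.length_replicate]
    exact TM2Iter.eval_mono q (by rw [length_boolPair]; omega)
  have hpc : ∀ t, (QF V (pieceF p (boolPair (boolPair x ρ) (ones t)))).length ≤ Q.eval (boolPair x ρ).length :=
    fun t => (hQ _).trans (TM2Iter.eval_mono Q (length_pieceF_apply_le x ρ t))
  have h1 : ∀ t, t < (ones (q.eval x.length)).length →
      (lenPieceF V p (boolPair (boolPair x ρ) (ones t))).length ≤ Q.eval (boolPair x ρ).length := by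
    intro t _
    have := hpc t
    have h' := length_fstF_sndF_le (QF V (pieceF p (boolPair (boolPair x ρ) (ones t))))
    simp only [lenPieceF, Function.comp_apply]
    omega
  have h2 : ∀ t, t < (ones (q.eval x.length)).length →
      (codePieceF V p (boolPair (boolPair x ρ) (ones t))).length ≤ Q.eval (boolPair x ρ).length := by
    intro t _
    have := hpc t
    have h' := length_fstF_sndF_le (QF V (pieceF p (boolPair (boolPair x ρ) (ones t))))
    simp only [codePieceF, Function.comp_apply]
    omega
  rw [QF', fanoutFn_apply, Function.comp_apply, Function.comp_apply, initF_boolPair, foldCat_apply hk h1,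
    foldCat_apply hk h2, List.length_replicate]
  have hq : (V.andRep p q).queries x ρ =
      (List.range (q.eval x.length)).flatMap fun j => V.queries x (block (p.eval x.length) j ρ) := by
    change ((List.range _).map _).flatMap _ = _
    rw [List.flatMap_map]
  rw [hq, encode_flatMap]
  congr 1
  · exact ccat_congr fun t _ => lenPieceF_apply x ρ t
  · exact ccat_congr fun t _ => codePieceF_apply x ρ t

/-- **`QF' ∈ FP`** for a polynomial-time `V`. [cite: AroraBarakCC2009, §1.3] -/
theorem QF'_mem_FP (hV : V.IsPolyTime) (Q : Polynomial ℕ) : QF' V p q Q ∈ FP := by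
  have hi : initF q ∈ FP := fanoutFn_mem_FP id_mem_FP (comp_mem_FP (polyFn_mem_FP q) fstF_mem_FP)
  have hl : lenPieceF V p ∈ FP := comp_mem_FP fstF_mem_FP (comp_mem_FP (QF_mem_FP hV) pieceF_mem_FP)
  have hc : codePieceF V p ∈ FP := comp_mem_FP sndF_mem_FP (comp_mem_FP (QF_mem_FP hV) pieceF_mem_FP)
  exact fanoutFn_mem_FP (comp_mem_FP (foldCat_mem_FP Q q hl) hi) (comp_mem_FP (foldCat_mem_FP Q q hc) hi)

/-! #### The decision map -/

variable (V p q)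

/-- On `w = ⟨⟨rest, b⟩, ⟨x, blk⟩⟩`: the unary length `1^ℓ` of the query list of the block. [folklore] -/
def lenQF : List Bool → List Bool := fstF ∘ QF V ∘ sndF

/-- The not-yet-consumed answers `rest`. [folklore] -/
def restF : List Bool → List Bool := fstF ∘ fstF

/-- The answer segment of the block: `rest ↾ ℓ`. [folklore] -/
def segF : List Bool → List Bool := takeFn ∘ fanoutFn (lenQF V) restF

/-- The remaining answers: `rest ↓ ℓ`. [folklore] -/
def remF : List Bool → List Bool := dropFn ∘ fanoutFn (lenQF V) restF

/-- The decision of the block run: `DF V ⟨x, ⟨blk, rest ↾ ℓ⟩⟩`. [folklore] -/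
def decF : List Bool → List Bool := DF V ∘ fanoutFn (fstF ∘ sndF) (fanoutFn (sndF ∘ sndF) (segF V))

/-- **The fold operation of the decision**: `⟨⟨rest, [b]⟩, ⟨x, blk⟩⟩ ↦ ⟨rest ↓ ℓ, [b ∧ V.decide x blk (rest ↾ ℓ)]⟩`.
[cite: AroraBarakCC2009, Remark 11.6 (2)] -/
def repOp : List Bool → List Bool := fanoutFn (remF V) (andOp ∘ fanoutFn (sndF ∘ fstF) (decF V))

/-- On `w = ⟨x, ⟨ρ, a⟩⟩`: the loop record `⟨⟨x, ρ⟩, ⟨bin q(|x|), ⟨1⁰, ⟨a, [1]⟩⟩⟩⟩`. [folklore] -/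
def dinitF : List Bool → List Bool :=
  fanoutFn (fanoutFn (nthF 0) (nthF 1))
    (fanoutFn (lenBinF ∘ polyFn q ∘ nthF 0) (fanoutFn (fun _ => []) (fanoutFn (sndPow 1) fun _ => [true])))

/-- **The decision map of `andRep V p q` as a total string function**: the counted fold of `repOp`
over the pieces, then the conjunction bit. [cite: AroraBarakCC2009, Remark 11.6 (2) with §1.3] -/
def DF' : List Bool → List Bool := sndF ∘ sndPow 2 ∘ foldLoop (repOp V) (clipF 2 (pieceF p)) q ∘ dinitF q

variable {V p q}

/-- **Value of the fold operation.** [folklore] -/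
theorem repOp_apply (rest : List Bool) (b : Bool) (x blk : List Bool) :
    repOp V (boolPair (boolPair rest [b]) (boolPair x blk)) =
      boolPair (rest.drop (V.queries x blk).length) [b && V.decide x blk (rest.take (V.queries x blk).length)] := by
  have hlen : lenQF V (boolPair (boolPair rest [b]) (boolPair x blk)) = ones (V.queries x blk).length := by
    simp only [lenQF, Function.comp_apply, sndF_boolPair, QF_boolPair, encode_listNat_eq, fstF_boolPair]
  have hseg : segF V (boolPair (boolPair rest [b]) (boolPair x blk)) = rest.take (V.queries x blk).length := by
    simp only [segF, restF, Function.comp_apply, fanoutFn_apply, hlen, fstF_boolPair, takeFn_boolPair, List.length_replicate]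
  have hrem : remF V (boolPair (boolPair rest [b]) (boolPair x blk)) = rest.drop (V.queries x blk).length := by
    simp only [remF, restF, Function.comp_apply, fanoutFn_apply, hlen, fstF_boolPair, dropFn_boolPair, List.length_replicate]
  have hdec : decF V (boolPair (boolPair rest [b]) (boolPair x blk)) =
      [V.decide x blk (rest.take (V.queries x blk).length)] := by
    simp only [decF, Function.comp_apply, fanoutFn_apply, sndF_boolPair, fstF_boolPair, hseg, DF_record]
  rw [repOp, fanoutFn_apply, hrem, Function.comp_apply, fanoutFn_apply, hdec]
  simp only [Function.comp_apply, fstF_boolPair, sndF_boolPair, andOp_boolPair]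

/-- **Additive growth of the fold operation** (on every input): `|repOp V w| ≤ |fstF w| + |sndF w| + 3`. [folklore] -/
theorem length_repOp_le (w : List Bool) : (repOp V w).length ≤ (fstF w).length + (sndF w).length + 3 := by
  rw [repOp, length_fanoutFn]
  have h1 : (remF V w).length ≤ (fstF (fstF w)).length := by
    simp only [remF, restF, Function.comp_apply, fanoutFn_apply, dropFn_boolPair, List.length_drop]
    omega
  have h2 := length_fstF_sndF_le (fstF w)
  have h3 : ((andOp ∘ fanoutFn (sndF ∘ fstF) (decF V)) w).length = 1 := oneBit_andOp.length_eq _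
  rw [h3]
  omega

/-- **Semantics of the decision fold**: from `⟨rest, [b]⟩`, `k` rounds from index `i` give
`⟨rest', [b ∧ repDecide x [blk i, …, blk (i+k-1)] rest]⟩`. [folklore] -/
theorem foldAcc_repOp {f : List Bool → List Bool} {x ρ : List Bool} (blk : ℕ → List Bool)
    (hf : ∀ j, f (boolPair (boolPair x ρ) (ones j)) = boolPair x (blk j)) :
    ∀ (k i : ℕ) (rest : List Bool) (b : Bool), ∃ rest' : List Bool,
      foldAcc (repOp V) f (boolPair x ρ) i k (boolPair rest [b]) =
        boolPair rest' [b && V.repDecide x ((List.range k).map fun j => blk (i + j)) rest]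
  | 0, i, rest, b => ⟨rest, by simp [PCPVerifier.repDecide]⟩
  | k + 1, i, rest, b => by
    obtain ⟨rest', h⟩ := foldAcc_repOp blk hf k (i + 1) (rest.drop (V.queries x (blk i)).length)
      (b && V.decide x (blk i) (rest.take (V.queries x (blk i)).length))
    refine ⟨rest', ?_⟩
    have hlist : ((List.range (k + 1)).map fun j => blk (i + j)) =
        blk i :: (List.range k).map fun j => blk (i + 1 + j) := by
      rw [List.range_succ_eq_map, List.map_cons, List.map_map, Nat.add_zero]
      congr 1
      refine List.map_congr_left fun j _ => ?_
      simp only [Function.comp_apply, Nat.succ_eq_add_one]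
      congr 1
      omega
    rw [foldAcc_succ, hf, repOp_apply, h, hlist, PCPVerifier.repDecide, Bool.and_assoc]

/-- `dinitF q` on a record. [folklore] -/
theorem dinitF_record (x ρ a : List Bool) :
    dinitF q (boolPair x (boolPair ρ a)) =
      boolPair (boolPair x ρ) (boolPair (encodeNat (q.eval x.length)) (boolPair (ones 0) (boolPair a [true]))) := by
  simp [dinitF, ones]

/-- **Value of the decision map** on a record: `DF' ⟨x, ⟨ρ, a⟩⟩ = [(andRep V p q).decide x ρ a]`.
[cite: AroraBarakCC2009, Remark 11.6 (2)] -/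
theorem DF'_record (x ρ a : List Bool) : DF' V p q (boolPair x (boolPair ρ a)) = [(V.andRep p q).decide x ρ a] := by
  have hk : q.eval x.length ≤ q.eval (boolPair x ρ).length := TM2Iter.eval_mono q (by rw [length_boolPair]; omega)
  obtain ⟨rest', h⟩ := foldAcc_repOp (V := V) (f := pieceF p) (x := x) (ρ := ρ)
    (fun j => block (p.eval x.length) j ρ) (fun j => pieceF_apply x ρ j) (q.eval x.length) 0 a true
  rw [DF', Function.comp_apply, Function.comp_apply, Function.comp_apply, dinitF_record, foldLoop_apply _ _ hk,
    foldAcc_clipF (fun j _ _ => by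
      have := length_pieceF_le (p := p) (boolPair (boolPair x ρ) (ones j)); rwa [fstF_boolPair] at this), h]
  simp only [sndPow_succ_boolPair, sndPow_zero_boolPair, sndF_boolPair, Bool.true_and, Nat.zero_add]
  rfl

/-- **`DF' ∈ FP`** for a polynomial-time `V`. [cite: AroraBarakCC2009, §1.3] -/
theorem DF'_mem_FP (hV : V.IsPolyTime) : DF' V p q ∈ FP := by
  have hlen : lenQF V ∈ FP := comp_mem_FP fstF_mem_FP (comp_mem_FP (QF_mem_FP hV) sndF_mem_FP)
  have hrest : restF ∈ FP := comp_mem_FP fstF_mem_FP fstF_mem_FP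
  have hseg : segF V ∈ FP := comp_mem_FP takeFn_mem_FP (fanoutFn_mem_FP hlen hrest)
  have hrem : remF V ∈ FP := comp_mem_FP dropFn_mem_FP (fanoutFn_mem_FP hlen hrest)
  have hdec : decF V ∈ FP := comp_mem_FP (DF_mem_FP hV) (fanoutFn_mem_FP (comp_mem_FP fstF_mem_FP sndF_mem_FP)
    (fanoutFn_mem_FP (comp_mem_FP sndF_mem_FP sndF_mem_FP) hseg))
  have hop : repOp V ∈ FP := fanoutFn_mem_FP hrem (comp_mem_FP andOp_mem_FP
    (fanoutFn_mem_FP (comp_mem_FP sndF_mem_FP fstF_mem_FP) hdec))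
  have hinit : dinitF q ∈ FP := fanoutFn_mem_FP (fanoutFn_mem_FP (nthF_mem_FP 0) (nthF_mem_FP 1))
    (fanoutFn_mem_FP (comp_mem_FP lenBinF_mem_FP (comp_mem_FP (polyFn_mem_FP q) (nthF_mem_FP 0)))
      (fanoutFn_mem_FP (const_mem_FP _) (fanoutFn_mem_FP (sndPow_mem_FP 1) (const_mem_FP _))))
  exact comp_mem_FP sndF_mem_FP (comp_mem_FP (sndPow_mem_FP 2)
    (comp_mem_FP (foldLoop_clipF_mem_FP 2 hop length_repOp_le pieceF_mem_FP q) hinit))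

end PCPAmp

/-! ### The repeated verifier is polynomial time -/

namespace PCPVerifier

variable {V : PCPVerifier}

/-- **`andRep V p q` is polynomial time when `V` is.** [cite: AroraBarakCC2009, Remark 11.6 (2) with §1.3] -/
theorem isPolyTime_andRep (hV : V.IsPolyTime) (p q : Polynomial ℕ) : (V.andRep p q).IsPolyTime := by
  obtain ⟨s, hs⟩ := PCPExact.exists_poly_length_QF hV
  refine ⟨?_, ?_, ⟨q * p, fun n => (coins_andRep_eq p q n).le⟩⟩
  · exact PolyTimeComputable.of_encode_eq (ea := _root_.id) (eb := _root_.id) (f := PCPAmp.QF' V p q s)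
      (fun pr : List Bool × List Bool => boolPair pr.1 pr.2) (fun pr => id_eq (boolPair pr.1 pr.2))
      (fun pr => (id_eq _).trans (PCPAmp.QF'_boolPair hs pr.1 pr.2)) (PCPAmp.QF'_mem_FP hV s)
  · exact PolyTimeComputable.of_encode_eq (ea := _root_.id) (eb := _root_.id) (f := PCPAmp.DF' V p q)
      (fun t : List Bool × List Bool × List Bool => boolPair t.1 (boolPair t.2.1 t.2.2))
      (fun t => id_eq (boolPair t.1 (boolPair t.2.1 t.2.2)))
      (fun t => (id_eq _).trans (PCPAmp.DF'_record t.1 t.2.1 t.2.2)) (PCPAmp.DF'_mem_FP hV)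

/-- **Soundness amplification, packaged**: a polynomial-time verifier run with exactly `p(n)` coins,
complete for `π` on `L` and with soundness error `1 - 1/(m(n)+1)` off `L`, yields a polynomial-time
verifier run with exactly `(m+1)(n) · p(n)` coins, complete for the same proofs and with soundness
error `1/2`. [cite: AroraBarakCC2009, Remark 11.6 (2)] -/
theorem exists_amplified {L : Set (List Bool)} {prf : List Bool → ℕ → Bool} (hV : V.IsPolyTime)
    {p m : Polynomial ℕ} (hc : ∀ n, V.coins n = p.eval n)
    (hcomp : ∀ x ∈ L, V.acceptProb x (prf x) = 1)
    (hsound : ∀ x ∉ L, ∀ π, V.acceptProb x π ≤ 1 - 1 / (((m.eval x.length : ℕ) : ℝ) + 1)) :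
    ∃ V' : PCPVerifier, V'.IsPolyTime ∧ (∀ n, V'.coins n = ((m + 1) * p).eval n) ∧
      (∀ x ∈ L, V'.acceptProb x (prf x) = 1) ∧ (∀ x ∉ L, ∀ π, V'.acceptProb x π ≤ 1 / 2) :=
  ⟨V.andRep p (m + 1), isPolyTime_andRep hV p (m + 1), coins_andRep_eq p (m + 1),
    fun x hx => acceptProb_andRep_eq_one hc _ (hcomp x hx), fun x hx π => acceptProb_andRep_le_half hc (hsound x hx π)⟩

end PCPVerifier

end Literature.Computability.Complexity
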